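import Mathlib.RingTheory.NoetherNormalization
import Summits.ResolutionOfSingularities.ResolutionOfSingularities.Theorems.FrobeniusLadderFInjectiveMacaulayficationFTemkinClosedPoints
import Summits.ResolutionOfSingularities.ResolutionOfSingularities.Theorems.FrobeniusLadderFInjectiveMacaulayficationAdmissibleLocalCentre
import Literature.AlgebraicGeometry.Resolution.BlowupsLocal
import HarnessLib

/-!
# NON-CLOSED POINTS ARE CLOSED POINTS OVER THE RESIDUE TRANSCENDENCE FIELD: `𝒪_{X,x} ≅ 𝒪_{Y,y}` with `y` CLOSED on an affine
# variety `Y` over `K = k(X₁,…,X_r)`, `dim Y = dim 𝒪_{X,x}` (crux `FInjectiveMacaulayfication` stmt-ResolutionOfSingularities-15315,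
# chain w45a; res-L1-w45a-plan-1 GO 2026-08-28T02:24:33Z on this seat's default object, res-L1-w45a-tri-2 PRE-AUDIT 02:24:02Z (three
# cautions, binding); seat res-L1-w45a-stub-3 g8)

[OURS · L1 W4.5a] Support file (`--supports stmt-ResolutionOfSingularities-15315 --as helper`); replaces the role of NO printed item;
NOT a statement of any manuscript; def-free, unconditional, no named facts. AI-written (AI review is weaker than expert review).
It is the PROVED half of the ladder rung under door v36.2's resolution-side stub (LR_adm)
`RegularOffFiniteOfLRAdm.LocalResolutionNonClosedGe4Adm` (res-L1-w45a-stub-3 g7, p591519): the (LR_adm) body lives on the local scheme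
`Spec 𝒪_{X,x}` at a NON-CLOSED point `x`; this file shows that local scheme is, up to isomorphism, the local scheme of a CLOSED point
of a variety of dimension `dim 𝒪_{X,x}` over a finitely generated (in general IMPERFECT) extension `K` of `k` — so (LR_adm) is
«closed-point local Hironaka one dimension down, over finitely generated fields» (the companion definition-lane file
`…ClosedPointLocalResolutionAdm` states that rung and derives (LR_adm) from it).

## The three lemmas

* §1 `exists_closedPoint_chart_ring` (commutative algebra). `A` a domain of finite type over a field `k`, `𝔭` a prime, `L = A_𝔭`.
  Noether-normalise `A/𝔭` (Mathlib `exists_integral_inj_algHom_of_fg`): `k[X₁,…,X_r] ↪ A/𝔭` integral; lift the `Xᵢ` to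
  `s₁,…,s_r ∈ A`. A non-zero polynomial in the `sᵢ` is non-zero modulo `𝔭`, so `k[s] ∖ 0 ⊆ A ∖ 𝔭` and `K := k(X₁,…,X_r)`
  (LITERALLY `FractionRing (MvPolynomial (Fin r) k)`, so `trdeg_k K = r` by construction) maps into `L` (`IsLocalization.lift`).
  `B := K[A] ⊆ L` — the coordinate ring of the GENERIC FIBRE of `(s₁,…,s_r) : Spec A → 𝔸ʳ_k`, i.e. `A ⊗_{k[s]} k(s)` realised inside
  `L`; NOT the constant base change `A ⊗_k K` (res-L1-w45a-tri-2 caution (1)) — is a domain of finite type over `K` (generated by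
  generators of `A`); `𝔮 := 𝔪_L ∩ B` is MAXIMAL: `B/𝔮 ↪ κ(𝔭)` is generated over `K` by the image of `A/𝔭`, which is integral over
  `k[X] ⊆ K`, and an integral domain integral over a field is a field (`isField_of_isIntegral_of_isField'`); and `L = B_𝔮` on the nose
  (`IsLocalization.AtPrime L 𝔮`: fractions `a/u`, `u ∈ A ∖ 𝔭 ⊆ B ∖ 𝔮`).
* §2 `exists_closedPoint_model` (schemes). `X/k` integral locally of finite type, `x ∈ X` ANY point: with `A = Γ(X, U)` for an affine
  `U ∋ x` (`𝒪_{X,x} = A_𝔭`, `IsAffineOpen.isLocalization_stalk`), `Y := Spec B` is AFFINE, INTEGRAL, (separated,) of finite type over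
  `K` (`[Field K] [CharP K p]`, ARBITRARY/imperfect — caution (2)), `y := 𝔮` is CLOSED, `𝒪_{X,x} ≅ 𝒪_{Y,y}` (`IsLocalization.algEquiv`
  + `Spec.stalkIso`), and `dim Y = dim 𝒪_{X,x}` (closed points of integral varieties have full local dimension,
  `FTemkinClosedPoints.ringKrullDim_stalk_eq_of_isClosed`) — the well-foundedness bookkeeping (caution (3)): for `x` NON-closed on a
  `d`-fold, `dim Y = dim 𝒪_{X,x} ≤ d − 1` (`…ClosedPointLocalResolutionAdm.ringKrullDim_stalk_add_one_le_of_not_isClosed`). The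
  transcendence degree `r = d − dim 𝒪_{X,x}` is not separately recorded (the proofs never use it).
* §3 `localBody_of_iso`: the (LR_adm) body «every admissible blowing up of `Spec O` regular off the closed fibre admits a
  desingularization» moves along ring isomorphisms `O ≅ O'` (`IsBlowup.comp_iso`; admissibility by
  `AdmissibleLocalCentre.support_comap_subset_of_flat_of_isPreimmersion`; closed point ↦ closed point, `Spec_closedPoint`).

[folklore; cite: EGAIV2, (6.1.1)–(6.1.2) and §5 (generic fibres, dimension of local rings of varieties); Matsumura1987, §33 Lemma 2
(Noether normalisation) and Thm. 5.6; Temkin2008, §2.1 and Prop. 2.3.4 (iii); GortzWedhorn2020, Thm. 5.22]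
-/

-- single-problem summit: the doubled namespace component is forced
set_option linter.dupNamespace false

noncomputable section

namespace Summit.ResolutionOfSingularities.ResolutionOfSingularities.Theorems.FInjectiveMacaulayfication.NonClosedPointChart

open CategoryTheory AlgebraicGeometry TopologicalSpace IsLocalRing
open Literature.AlgebraicGeometry.Resolution

/-! ## §1 The ring lemma: `A_𝔭 = B_𝔮` with `B` of finite type over `K = k(s₁,…,s_r)` and `𝔮` maximal -/

/-- **`A_𝔭` is the local ring of a finite-type algebra over a purely transcendental extension at a MAXIMAL ideal.**
Let `A` be a domain of finite type over a field `k`, `𝔭` a prime ideal and `L = A_𝔭`. Then for some `r` (the transcendence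
degree of `κ(𝔭)` over `k`), with `K := k(X₁,…,X_r)` mapped into `L` by a lift `s` of a Noether normalisation of `A/𝔭`, the
`K`-subalgebra `B := K[A] ⊆ L` (the coordinate ring of the generic fibre of `s : Spec A → 𝔸ʳ_k`) is a domain of finite type over
`K`, `𝔮 := 𝔪_L ∩ B` is a MAXIMAL ideal (`B/𝔮 ⊆ κ(𝔭)` is integral over the field `K`), and `L = B_𝔮`.
[folklore; cite: EGAIV2, §6; Matsumura1987, §14 (dimension formula setting)] -/
theorem exists_closedPoint_chart_ring (k : Type) [Field k] (A : Type) [CommRing A] [IsDomain A] [Algebra k A]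
    [Algebra.FiniteType k A] (𝔭 : Ideal A) [𝔭.IsPrime] (L : Type) [CommRing L] [Algebra A L]
    [IsLocalization.AtPrime L 𝔭] :
    ∃ (r : ℕ) (B : Type) (_ : CommRing B) (_ : IsDomain B)
      (_ : Algebra (FractionRing (MvPolynomial (Fin r) k)) B)
      (_ : Algebra.FiniteType (FractionRing (MvPolynomial (Fin r) k)) B)
      (𝔮 : Ideal B) (_ : 𝔮.IsMaximal) (_ : Algebra B L), IsLocalization.AtPrime L 𝔮 := by
  classical
  haveI : IsLocalRing L := IsLocalization.AtPrime.isLocalRing L 𝔭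
  haveI : IsDomain L := IsLocalization.isDomain_of_atPrime L 𝔭
  -- Step 1: Noether normalisation of `D = A/𝔭`
  haveI : Nontrivial (A ⧸ 𝔭) := Ideal.Quotient.nontrivial_iff.mpr Ideal.IsPrime.ne_top'
  obtain ⟨r, g, hginj, hgint⟩ := exists_integral_inj_algHom_of_fg k (A ⧸ 𝔭)
  -- Step 2: lift the normalising elements to `A`
  choose s hs using fun i : Fin r => Ideal.Quotient.mk_surjective (I := 𝔭) (g (MvPolynomial.X i))
  let φ : MvPolynomial (Fin r) k →ₐ[k] A := MvPolynomial.aeval s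
  have hφg : ∀ P, Ideal.Quotient.mk 𝔭 (φ P) = g P := by
    intro P
    have h : (Ideal.Quotient.mkₐ k 𝔭).comp φ = g :=
      MvPolynomial.algHom_ext fun i => by simp [φ, hs]
    exact DFunLike.congr_fun h P
  have hφ𝔭 : ∀ P : MvPolynomial (Fin r) k, P ≠ 0 → φ P ∈ 𝔭.primeCompl := by
    intro P hP h
    refine hP (hginj ?_)
    rw [← hφg, Ideal.Quotient.eq_zero_iff_mem.mpr h, map_zero]
  -- Step 3: `K = k(X₁,…,X_r) → L`
  have hunit : ∀ y : nonZeroDivisors (MvPolynomial (Fin r) k),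
      IsUnit (((algebraMap A L).comp φ.toRingHom) y) := fun y =>
    IsLocalization.map_units L ⟨φ y, hφ𝔭 y (nonZeroDivisors.ne_zero y.2)⟩
  let ψK : FractionRing (MvPolynomial (Fin r) k) →+* L := IsLocalization.lift hunit
  have hψK : ∀ P, ψK (algebraMap _ (FractionRing (MvPolynomial (Fin r) k)) P) = algebraMap A L (φ P) :=
    fun P => IsLocalization.lift_eq hunit P
  letI : Algebra (FractionRing (MvPolynomial (Fin r) k)) L := ψK.toAlgebra
  -- Step 4: `B := K[A] ⊆ L`
  let θ : A →+* L := algebraMap A L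
  let B : Subalgebra (FractionRing (MvPolynomial (Fin r) k)) L :=
    Algebra.adjoin (FractionRing (MvPolynomial (Fin r) k)) (Set.range θ)
  -- finite type: `A = k[t]` for a finite `t`, and `B = K[θ t]`
  obtain ⟨t, ht⟩ := Algebra.FiniteType.out (R := k) (A := A)
  have hBt : B = Algebra.adjoin (FractionRing (MvPolynomial (Fin r) k)) (θ '' (t : Set A)) := by
    apply le_antisymm
    · refine Algebra.adjoin_le ?_
      rintro _ ⟨a, rfl⟩
      have ha : a ∈ Algebra.adjoin k (t : Set A) := by rw [ht]; trivial
      refine Algebra.adjoin_induction (hx := ha) ?_ ?_ ?_ ?_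
      · exact fun x hx => Algebra.subset_adjoin ⟨x, hx, rfl⟩
      · intro c
        have hc : θ (algebraMap k A c) =
            ψK (algebraMap (MvPolynomial (Fin r) k) (FractionRing (MvPolynomial (Fin r) k)) (MvPolynomial.C c)) := by
          rw [hψK, ← MvPolynomial.algebraMap_eq, AlgHom.commutes]
        rw [hc]
        exact Subalgebra.algebraMap_mem (Algebra.adjoin (FractionRing (MvPolynomial (Fin r) k)) (θ '' (t : Set A)))
          (algebraMap (MvPolynomial (Fin r) k) (FractionRing (MvPolynomial (Fin r) k)) (MvPolynomial.C c))
      · intro x y _ _ hx hy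
        rw [map_add]; exact add_mem hx hy
      · intro x y _ _ hx hy
        rw [map_mul]; exact mul_mem hx hy
    · exact Algebra.adjoin_mono (Set.image_subset_range _ _)
  have hBfg : B.FG := by rw [hBt, ← Finset.coe_image]; exact Subalgebra.fg_adjoin_finset _
  haveI hBft : Algebra.FiniteType (FractionRing (MvPolynomial (Fin r) k)) B := B.fg_iff_finiteType.mp hBfg
  -- Step 5: `𝔮 := 𝔪_L ∩ B` is maximal
  let 𝔮 : Ideal B := (maximalIdeal L).comap B.val.toRingHom
  haveI h𝔮p : 𝔮.IsPrime := Ideal.comap_isPrime _ _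
  -- the residue field and the map `δ : A/𝔭 → κ`
  let res : L →+* ResidueField L := residue L
  have hresθ : ∀ a ∈ 𝔭, res (θ a) = 0 := by
    intro a ha
    rw [residue_eq_zero_iff]
    exact (IsLocalization.AtPrime.to_map_mem_maximal_iff L 𝔭 a).mpr ha
  let δ : A ⧸ 𝔭 →+* ResidueField L := Ideal.Quotient.lift 𝔭 (res.comp θ) hresθ
  -- `κ` as an algebra over `k[X]` and over `K`, towers
  letI algκK : Algebra (FractionRing (MvPolynomial (Fin r) k)) (ResidueField L) := (res.comp ψK).toAlgebra
  letI algκP : Algebra (MvPolynomial (Fin r) k) (ResidueField L) :=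
    ((res.comp ψK).comp (algebraMap (MvPolynomial (Fin r) k) (FractionRing (MvPolynomial (Fin r) k)))).toAlgebra
  haveI : IsScalarTower (MvPolynomial (Fin r) k) (FractionRing (MvPolynomial (Fin r) k)) (ResidueField L) :=
    IsScalarTower.of_algebraMap_eq (fun _ => rfl)
  have hδg : δ.comp g.toRingHom = algebraMap (MvPolynomial (Fin r) k) (ResidueField L) := by
    have hR : ∀ P, algebraMap (MvPolynomial (Fin r) k) (ResidueField L) P = res (θ (φ P)) := fun P => by
      rw [RingHom.algebraMap_toAlgebra, RingHom.comp_apply, RingHom.comp_apply, hψK]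
    refine MvPolynomial.ringHom_ext (fun c => ?_) (fun i => ?_)
    · rw [hR, ← MvPolynomial.algebraMap_eq, AlgHom.commutes, RingHom.comp_apply, AlgHom.toRingHom_eq_coe,
        AlgHom.coe_toRingHom, AlgHom.commutes, ← Ideal.Quotient.mk_algebraMap]
      show Ideal.Quotient.lift 𝔭 (res.comp θ) hresθ (Ideal.Quotient.mk 𝔭 _) = _
      rw [Ideal.Quotient.lift_mk, RingHom.comp_apply]
    · rw [hR, RingHom.comp_apply, AlgHom.toRingHom_eq_coe, AlgHom.coe_toRingHom, ← hs i]
      show Ideal.Quotient.lift 𝔭 (res.comp θ) hresθ (Ideal.Quotient.mk 𝔭 _) = _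
      rw [Ideal.Quotient.lift_mk, RingHom.comp_apply]
      simp [φ]
  -- every `δ ā` is integral over `K`
  have hint : ∀ ā : A ⧸ 𝔭, IsIntegral (FractionRing (MvPolynomial (Fin r) k)) (δ ā) := by
    intro ā
    obtain ⟨P, hPm, hP⟩ := hgint ā
    have hPκ : IsIntegral (MvPolynomial (Fin r) k) (δ ā) := by
      refine ⟨P, hPm, ?_⟩
      rw [← hδg, ← Polynomial.hom_eval₂, hP, map_zero]
    exact hPκ.tower_top
  -- `ψ : B → κ`, its kernel is `𝔮`, its range is a field
  let ψ : B →ₐ[FractionRing (MvPolynomial (Fin r) k)] ResidueField L :=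
    { toRingHom := res.comp B.val.toRingHom, commutes' := fun c => rfl }
  have hkerψ : RingHom.ker ψ.toRingHom = 𝔮 := by
    show RingHom.ker (res.comp B.val.toRingHom) = 𝔮
    rw [← RingHom.comap_ker, ker_residue]
  have hψint : Algebra.IsIntegral (FractionRing (MvPolynomial (Fin r) k)) ψ.range := by
    constructor
    rintro ⟨y, b, rfl⟩
    rw [← isIntegral_algHom_iff ψ.range.val Subtype.val_injective]
    show IsIntegral _ (ψ b)
    -- `b ∈ K[θ A]`: induction on adjoin
    obtain ⟨b, hb⟩ := b
    refine Algebra.adjoin_induction (hx := hb) ?_ ?_ ?_ ?_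
    · rintro _ ⟨a, rfl⟩
      have : ψ ⟨θ a, Algebra.subset_adjoin ⟨a, rfl⟩⟩ = δ (Ideal.Quotient.mk 𝔭 a) := by
        simp [ψ, δ]
      rw [this]; exact hint _
    · intro c
      have hc : (⟨algebraMap _ L c, Subalgebra.algebraMap_mem B c⟩ : B) = algebraMap _ B c := Subtype.ext rfl
      rw [hc, AlgHom.commutes]; exact isIntegral_algebraMap
    · intro x y hx hy hix hiy
      have : ψ ⟨x + y, add_mem hx hy⟩ = ψ ⟨x, hx⟩ + ψ ⟨y, hy⟩ := by
        rw [← map_add]; rfl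
      rw [this]; exact hix.add hiy
    · intro x y hx hy hix hiy
      have : ψ ⟨x * y, mul_mem hx hy⟩ = ψ ⟨x, hx⟩ * ψ ⟨y, hy⟩ := by
        rw [← map_mul]; rfl
      rw [this]; exact hix.mul hiy
  have hfield : IsField ψ.range :=
    isField_of_isIntegral_of_isField' (Field.toIsField (FractionRing (MvPolynomial (Fin r) k)))
  haveI h𝔮max : 𝔮.IsMaximal := by
    have hsurj : Function.Surjective ψ.rangeRestrict := fun ⟨y, b, hb⟩ => ⟨b, Subtype.ext hb⟩
    have hker : RingHom.ker ψ.rangeRestrict.toRingHom = 𝔮 := by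
      rw [← hkerψ]; ext b; simp [RingHom.mem_ker, Subtype.ext_iff]
    rw [← hker]
    exact Ideal.Quotient.maximal_of_isField _
      (MulEquiv.isField hfield (RingHom.quotientKerEquivOfSurjective hsurj).toMulEquiv)
  -- Step 6: `L = B_𝔮`
  letI algBL : Algebra B L := B.val.toRingHom.toAlgebra
  have halg : ∀ b : B, algebraMap B L b = (b : L) := fun _ => rfl
  have hloc : IsLocalization.AtPrime L 𝔮 := by
    rw [IsLocalization.AtPrime, isLocalization_iff]
    refine ⟨?_, ?_, ?_⟩
    · rintro ⟨b, hb⟩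
      rw [halg]
      have hb' : (b : L) ∉ maximalIdeal L := hb
      exact IsLocalRing.notMem_maximalIdeal.mp hb'
    · intro z
      obtain ⟨⟨a, u⟩, hz⟩ := IsLocalization.surj 𝔭.primeCompl z
      have hu : θ u ∉ maximalIdeal L := fun h =>
        u.2 ((IsLocalization.AtPrime.to_map_mem_maximal_iff L 𝔭 u.1).mp h)
      exact ⟨⟨⟨θ a, Algebra.subset_adjoin ⟨a, rfl⟩⟩, ⟨⟨θ u, Algebra.subset_adjoin ⟨u.1, rfl⟩⟩, hu⟩⟩, hz⟩
    · intro x y hxy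
      rw [halg, halg] at hxy
      exact ⟨1, by rw [Subtype.ext hxy]⟩
  exact ⟨r, B, inferInstance, inferInstance, inferInstance, hBft, 𝔮, h𝔮max, algBL, hloc⟩

/-! ## §2 The scheme lemma: every point of a variety is a CLOSED point of an affine variety over `k(X₁,…,X_r)` with the same
local ring -/

/-- `k(X₁,…,X_r)` has the characteristic of `k`. [plumbing] -/
theorem charP_fractionRing_mvPolynomial (p : ℕ) (k : Type) [Field k] [CharP k p] (r : ℕ) :
    CharP (FractionRing (MvPolynomial (Fin r) k)) p :=
  charP_of_injective_algebraMap (algebraMap k (FractionRing (MvPolynomial (Fin r) k))).injective p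

/-- **NON-CLOSED POINTS ARE CLOSED POINTS OVER THE RESIDUE TRANSCENDENCE FIELD.** Let `X` be an integral scheme locally of
finite type over a field `k` and `x ∈ X` ANY point. Then for some `r` there are an AFFINE INTEGRAL scheme `Y` (separated and) of
finite type over the purely transcendental extension `K = k(X₁,…,X_r)` — the coordinate ring of `Y` is `K[Γ(X, U)] ⊆ 𝒪_{X,x}`,
the generic fibre of `(s₁,…,s_r) : U → 𝔸ʳ_k` for an affine `U ∋ x` and a lift `s` of a Noether normalisation of `κ(x)`'s order
`Γ(X,U)/𝔭_x`; it is NOT the constant base change `X ⊗_k K` — and a CLOSED point `y ∈ Y` with `𝒪_{X,x} ≅ 𝒪_{Y,y}`; moreover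
`dim Y = dim 𝒪_{X,x}` (so for `x` non-closed on a `d`-fold, `dim Y ≤ d − 1`). `K` is in general IMPERFECT.
[folklore; cite: EGAIV2, §6 (generic fibres); Temkin2008, §2.1] -/
theorem exists_closedPoint_model (p : ℕ) {k : Type} [Field k] [CharP k p] {X : Scheme.{0}} (f : X ⟶ Spec (.of k))
    [LocallyOfFiniteType f] [IsIntegral X] (x : X) :
    ∃ (r : ℕ) (Y : Scheme.{0}) (g : Y ⟶ Spec (.of (FractionRing (MvPolynomial (Fin r) k)))) (y : Y),
      IsAffine Y ∧ IsIntegral Y ∧ IsSeparated g ∧ LocallyOfFiniteType g ∧ QuasiCompact g ∧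
      IsClosed ({y} : Set Y) ∧ Nonempty (X.presheaf.stalk x ≅ Y.presheaf.stalk y) ∧
      topologicalKrullDim Y = ringKrullDim (X.presheaf.stalk x) := by
  classical
  -- an affine open `U ∋ x`; `Γ(X, U)` is a finite type `k`-domain and `𝒪_{X,x} = Γ(X, U)_𝔭`
  obtain ⟨_, ⟨U, hU, rfl⟩, hxU, -⟩ := X.isBasis_affineOpens.exists_subset_of_mem_open (Set.mem_univ x) isOpen_univ
  haveI : Nonempty (U : X.Opens) := ⟨⟨x, hxU⟩⟩
  have h1 : (f.appLE ⊤ U le_top).hom.FiniteType := f.finiteType_appLE (isAffineOpen_top _) hU le_top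
  have h2 : (Scheme.ΓSpecIso (.of k)).inv.hom.FiniteType :=
    RingHom.FiniteType.of_surjective _ (Scheme.ΓSpecIso (.of k)).symm.commRingCatIsoToRingEquiv.surjective
  letI : Algebra k Γ(X, U) := ((f.appLE ⊤ U le_top).hom.comp (Scheme.ΓSpecIso (.of k)).inv.hom).toAlgebra
  haveI : Algebra.FiniteType k Γ(X, U) := h1.comp h2
  letI := TopCat.Presheaf.algebra_section_stalk X.presheaf (⟨x, hxU⟩ : U)
  haveI : IsLocalization.AtPrime (X.presheaf.stalk x) (hU.primeIdealOf ⟨x, hxU⟩).asIdeal := hU.isLocalization_stalk ⟨x, hxU⟩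
  -- the ring lemma
  obtain ⟨r, B, _, _, _, hBft, 𝔮, h𝔮, algBL, hloc⟩ :=
    exists_closedPoint_chart_ring k Γ(X, U) (hU.primeIdealOf ⟨x, hxU⟩).asIdeal (X.presheaf.stalk x)
  letI := algBL
  haveI := hloc
  haveI := h𝔮
  -- `Y := Spec B`, `y := 𝔮`
  let y : Spec (.of B) := ⟨𝔮, h𝔮.isPrime⟩
  have hft : LocallyOfFiniteType (Spec.map (CommRingCat.ofHom (algebraMap (FractionRing (MvPolynomial (Fin r) k)) B))) :=
    HasRingHomProperty.Spec_iff.mpr (RingHom.finiteType_algebraMap.mpr hBft)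
  -- the stalk isomorphism `𝒪_{X,x} = B_𝔮 = 𝒪_{Y,y}`
  let e : X.presheaf.stalk x ≅ (Spec (.of B)).presheaf.stalk y :=
    (IsLocalization.algEquiv 𝔮.primeCompl (X.presheaf.stalk x) (Localization.AtPrime 𝔮)).toRingEquiv.toCommRingCatIso ≪≫
      (Spec.stalkIso (.of B) y).symm
  -- dimension bookkeeping
  haveI : LocallyOfFiniteType (Spec.map (CommRingCat.ofHom (algebraMap (FractionRing (MvPolynomial (Fin r) k)) B))) := hft
  have hycl : IsClosed ({y} : Set (Spec (.of B))) := (PrimeSpectrum.isClosed_singleton_iff_isMaximal y).mpr h𝔮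
  obtain ⟨d₀, hd₀⟩ := exists_topologicalKrullDim_le_of_locallyOfFiniteType
    (Spec.map (CommRingCat.ofHom (algebraMap (FractionRing (MvPolynomial (Fin r) k)) B)))
  obtain ⟨d, hd⟩ := exists_topologicalKrullDim_eq_nat hd₀
  have hdimy : ringKrullDim ((Spec (.of B)).presheaf.stalk y) = d :=
    FTemkinClosedPoints.ringKrullDim_stalk_eq_of_isClosed
      (Spec.map (CommRingCat.ofHom (algebraMap (FractionRing (MvPolynomial (Fin r) k)) B))) hd y hycl
  have hdimx : ringKrullDim (X.presheaf.stalk x) = d := by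
    rw [ringKrullDim_eq_of_ringEquiv e.commRingCatIsoToRingEquiv, hdimy]
  exact ⟨r, Spec (.of B), Spec.map (CommRingCat.ofHom (algebraMap _ B)), y, inferInstance, inferInstance, inferInstance,
    hft, inferInstance, hycl, ⟨e⟩, by rw [hd, hdimx]⟩

/-! ## §3 The (LR_adm) body at a local scheme moves along isomorphisms of the local ring -/

/-- For an isomorphism of local rings `ε : O ≅ O'`, `Spec ε⁻¹ : Spec O ⟶ Spec O'` maps the closed point to the closed point.
[plumbing] -/
theorem specMap_inv_closedPoint {O O' : CommRingCat.{0}} [IsLocalRing O] [IsLocalRing O'] (ε : O ≅ O') :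
    (Spec.map ε.inv).base (closedPoint O) = closedPoint O' := by
  haveI : IsLocalHom ε.inv.hom := isLocalHom_of_isIso ε.inv
  exact Spec_closedPoint

/-- **The (LR_adm) body is invariant under isomorphisms of the local ring.** If every ADMISSIBLE blowing up of `Spec O'` that is
regular off the closed fibre admits a desingularization, the same holds for `Spec O` whenever `O ≅ O'`: compose the blowing up
with `Spec O ≅ Spec O'` (`IsBlowup.comp_iso`; the centre moves to its pull-back, which stays inside the singular locus, and the
closed point goes to the closed point); the source scheme is unchanged. [folklore] -/
theorem localBody_of_iso {O O' : CommRingCat.{0}} [IsLocalRing O] [IsLocalRing O'] (ε : O ≅ O')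
    (h : ∀ (S' : Scheme.{0}) (g : S' ⟶ Spec O') (I : (Spec O').IdealSheafData),
      IsBlowup g I → ((I.support : Set (Spec O')) ⊆ (Scheme.regularLocus (Spec O'))ᶜ) →
      (∀ s : S', s ∉ Scheme.regularLocus S' → g.base s = closedPoint O') → Scheme.AdmitsDesingularization S') :
    ∀ (S' : Scheme.{0}) (g : S' ⟶ Spec O) (I : (Spec O).IdealSheafData),
      IsBlowup g I → ((I.support : Set (Spec O)) ⊆ (Scheme.regularLocus (Spec O))ᶜ) →
      (∀ s : S', s ∉ Scheme.regularLocus S' → g.base s = closedPoint O) → Scheme.AdmitsDesingularization S' := by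
  intro S' g I hg hI hfib
  -- `e : Spec O ≅ Spec O'`, `e.hom = Spec ε⁻¹`, `e.inv = Spec ε`
  let e : Spec O ≅ Spec O' := (Scheme.Spec.mapIso ε.op).symm
  have hehom : e.hom = Spec.map ε.inv := rfl
  refine h S' (g ≫ e.hom) (I.comap e.inv) (hg.comp_iso e) ?_ ?_
  · exact AdmissibleLocalCentre.support_comap_subset_of_flat_of_isPreimmersion e.inv I hI
  · intro s hs
    rw [Scheme.Hom.comp_base, TopCat.comp_app, hfib s hs, hehom]
    exact specMap_inv_closedPoint ε

end Summit.ResolutionOfSingularities.ResolutionOfSingularities.Theorems.FInjectiveMacaulayfication.NonClosedPointChart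

end
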